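import Literature.Probability.LatticeModels.RandomClusterRimWiringOutside
import Literature.Probability.LatticeModels.BlockExplorationNested
import Literature.Probability.LatticeModels.RandomClusterEmbedding
import HarnessLib

/-!
# Transport of the conditional inside probabilities of an exploration datum along a window
embedding (proved)

Topic `Literature/Probability/LatticeModels` (trunk `StatMech`, family `crit-ising`); companion of
`BlockExplorationNested.lean` and `RandomClusterRimWiringOutside.lean`. In Kesten's ratio-limit
scheme in the planarity-free form of Basu–Sapozhnikov (ECP 22 (2017), §2) two finite supergraphs
`G₁` (on `V₁`), `G₂` (on `V₂`) of the same piece of lattice are compared; the only cross-graph input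
is that the CONDITIONAL inside probabilities `φ_{Gᵢ}[inside piece | datum (U, R)]` of a datum
inside the common window coincide. The window is an abstract finite type `W` embedded by
`ι₁ : W ↪ V₁`, `ι₂ : W ↪ V₂` with the same adjacency on the window, and a deep part `W₀ ⊆ W` whose
images have no neighbour off the window carries the datum.

* Transport along an embedding `ι : W ↪ V` (`ζ ↦ Sym2.map ι '' ζ`) of restricted connections,
  explored set, rim, datum event, wiring clause and inside piece (`image_mem_openConnIn_iff`,
  `explSet_image`, `explRim_image`, `image_mem_explEvent_iff`, `image_rimWired_iff`,
  `image_insidePiece_iff`).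
* `rcMeasure_real_explEvent_inter_mul_eq_sum_window` — one graph: the weight factorisation at the
  explored set (`rcPartitionFunction_mul_real_inter_mul_pow_eq_of_rim_wired_outside`) writes
  `φ_G(F ∩ A)` as (window sum of `F ∩ A`, living on `W`) × (factor independent of `A`); cluster
  counts on `V` and `W` differ by the number of idle vertices (`clusterCount_map_image`).
* `insideCond_eq_of_window_iso` — (T): `φ_{G₁}(F₁ ∩ A₁) φ_{G₂}(F₂) = φ_{G₂}(F₂ ∩ A₂) φ_{G₁}(F₁)`.

Everything is proved; no definitions, no named facts.

## References

* [BasuSapozhnikov2017ECP] D. Basu, A. Sapozhnikov, *Kesten's incipient infinite cluster and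
  quasi-multiplicativity of crossing probabilities*, Electron. Commun. Probab. 22 (2017), §2.
* H. Kesten, *Probab. Theory Related Fields* 73 (1986) 369–394, proof of Thm. 3.
* G. Grimmett, *The Random-Cluster Model*, Springer (2006): §4.2, Lemma (4.13); §4.3.
-/

open MeasureTheory Finset SimpleGraph
open Literature.Probability.Percolation (BondConfig openConnIn explEvent explSet explRim)

namespace Literature.Probability.LatticeModels

/-! ### Transport of configurations along an embedding of vertex types -/

section Transport

variable {V W : Type*} (ι : W ↪ V)

/-- A window pair is open in the pushed configuration iff it is open. [folklore] -/
theorem map_mk_mem_image_iff (ζ : BondConfig W) (a b : W) :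
    s(ι a, ι b) ∈ Sym2.map ι '' ζ ↔ s(a, b) ∈ ζ :=
  ⟨mem_of_map_mem_image ι, fun h => ⟨s(a, b), h, Sym2.map_mk _ _ _⟩⟩

/-- **Transport of restricted connections along an embedding**: `ι ζ ∈ {ι a ↔ ι b in ι S}` iff
`ζ ∈ {a ↔ b in S}` (every open edge of `ι ζ` joins two vertices of the range, so open paths of
`ι ζ` are images of open paths of `ζ`). [folklore] -/
theorem image_mem_openConnIn_iff (ζ : BondConfig W) (S : Set W) (a b : W) :
    Sym2.map ι '' ζ ∈ openConnIn (ι '' S) (ι a) (ι b) ↔ ζ ∈ openConnIn S a b := by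
  rw [Percolation.mem_openConnIn_iff_pathIn, Percolation.mem_openConnIn_iff_pathIn]
  constructor
  · rintro ⟨ha, h⟩
    have ha' : a ∈ S := ι.injective.mem_set_image.1 ha
    suffices key : ∀ v, Relation.ReflTransGen
        (fun x y => (Percolation.openGraph (Sym2.map ι '' ζ)).Adj x y ∧ y ∈ ι '' S) (ι a) v →
        ∀ c, v = ι c → Percolation.PathIn (Percolation.openGraph ζ) S a c from key _ h b rfl
    intro v hv
    induction hv with
    | refl =>
      intro c hc
      obtain rfl := ι.injective hc
      exact Percolation.PathIn.refl ha'
    | @tail u v _ huv ih =>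
      intro c hc
      subst hc
      obtain ⟨hadj, hcS⟩ := huv
      rw [Percolation.openGraph_adj] at hadj
      obtain ⟨⟨u', rfl⟩, -⟩ := mem_range_of_mem_image ι hadj.1
      have h1 : s(u', c) ∈ ζ := mem_of_map_mem_image ι hadj.1
      have h2 : u' ≠ c := fun h => hadj.2 (h ▸ rfl)
      exact (ih u' rfl).tail ((Percolation.openGraph_adj ζ u' c).2 ⟨h1, h2⟩)
        (ι.injective.mem_set_image.1 hcS)
  · rintro ⟨ha, h⟩
    refine ⟨Set.mem_image_of_mem ι ha, ?_⟩
    induction h with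
    | refl => exact Relation.ReflTransGen.refl
    | @tail u v _ huv ih =>
      obtain ⟨hadj, hvS⟩ := huv
      rw [Percolation.openGraph_adj] at hadj
      exact ih.tail ⟨(Percolation.openGraph_adj _ (ι u) (ι v)).2
        ⟨(map_mk_mem_image_iff ι ζ u v).2 hadj.1, ι.injective.ne hadj.2⟩,
        Set.mem_image_of_mem ι hvS⟩

/-- **The explored set of the pushed configuration** is the image of the explored set:
`𝒞(ι In, ι Blk; ι ζ) = ι 𝒞(In, Blk; ζ)`. [cite: BasuSapozhnikov2017ECP, §2 eq. (2.3)] -/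
theorem explSet_image (ζ : BondConfig W) (In Blk : Set W) :
    explSet (ι '' In) (ι '' Blk) (Sym2.map ι '' ζ) = ι '' explSet In Blk ζ := by
  ext v
  rw [Percolation.mem_explSet_iff, ← Set.image_union]
  constructor
  · rintro (⟨b, hb, rfl⟩ | ⟨⟨b, hb, rfl⟩, u, ⟨a, ha, rfl⟩, h⟩)
    · exact ⟨b, Percolation.subset_explSet In Blk ζ hb, rfl⟩
    · exact ⟨b, Or.inr ⟨hb, a, ha, (image_mem_openConnIn_iff ι ζ _ a b).1 h⟩, rfl⟩
  · rintro ⟨b, hb | ⟨hb, a, ha, h⟩, rfl⟩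
    · exact Or.inl ⟨b, hb, rfl⟩
    · exact Or.inr ⟨⟨b, hb, rfl⟩, ι a, ⟨a, ha, rfl⟩, (image_mem_openConnIn_iff ι ζ _ a b).2 h⟩

/-- **The rim of the pushed configuration** is the image of the rim:
`𝒟(ι In, ι Blk; ι ζ) = ι 𝒟(In, Blk; ζ)` (an open edge of `ι ζ` issuing from the range ends in the
range). [cite: BasuSapozhnikov2017ECP, §2 eq. (2.3)] -/
theorem explRim_image (ζ : BondConfig W) (In Blk : Set W) :
    explRim (ι '' In) (ι '' Blk) (Sym2.map ι '' ζ) = ι '' explRim In Blk ζ := by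
  ext w
  rw [Percolation.mem_explRim_iff, explSet_image]
  constructor
  · rintro ⟨hw, v, ⟨a, ha, rfl⟩, havw⟩
    obtain ⟨-, ⟨b, rfl⟩⟩ := mem_range_of_mem_image ι havw
    exact ⟨b, Percolation.mem_explRim_iff.2
      ⟨fun hb => hw ⟨b, hb, rfl⟩, a, ha, mem_of_map_mem_image ι havw⟩, rfl⟩
  · rintro ⟨b, hb, rfl⟩
    obtain ⟨hbE, a, ha, hab⟩ := Percolation.mem_explRim_iff.1 hb
    exact ⟨fun h => hbE (ι.injective.mem_set_image.1 h), ι a, ⟨a, ha, rfl⟩,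
      (map_mk_mem_image_iff ι ζ a b).2 hab⟩

/-- **The datum event is transported along the embedding**: `ι ζ ∈ {𝒞 = ι U, 𝒟 = ι R}` iff
`ζ ∈ {𝒞 = U, 𝒟 = R}`. [cite: BasuSapozhnikov2017ECP, §2, definition of F_i(U,R)] -/
theorem image_mem_explEvent_iff (ζ : BondConfig W) (In Blk U R : Set W) :
    Sym2.map ι '' ζ ∈ explEvent (ι '' In) (ι '' Blk) (ι '' U) (ι '' R) ↔
      ζ ∈ explEvent In Blk U R := by
  rw [Percolation.mem_explEvent_iff, Percolation.mem_explEvent_iff, explSet_image, explRim_image,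
    ι.injective.image_injective.eq_iff, ι.injective.image_injective.eq_iff]

/-- The clause "the rim is wired through the explored set" is transported along the embedding.
[cite: BasuSapozhnikov2017ECP, §2, paragraph after eq. (2.3)] -/
theorem image_rimWired_iff (ζ : BondConfig W) (U R : Set W) :
    (∀ r ∈ ι '' R, ∀ r₂ ∈ ι '' R, ∃ v ∈ ι '' U, ∃ v' ∈ ι '' U,
        s(v, r) ∈ Sym2.map ι '' ζ ∧ s(v', r₂) ∈ Sym2.map ι '' ζ ∧
          Sym2.map ι '' ζ ∈ openConnIn (ι '' U) v v') ↔
      ∀ r ∈ R, ∀ r₂ ∈ R, ∃ v ∈ U, ∃ v' ∈ U,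
        s(v, r) ∈ ζ ∧ s(v', r₂) ∈ ζ ∧ ζ ∈ openConnIn U v v' := by
  simp only [Set.forall_mem_image, Set.exists_mem_image, map_mk_mem_image_iff,
    image_mem_openConnIn_iff]

/-- The inside piece "`x` is joined inside `U` to a vertex carrying an open edge to `R`" is
transported along the embedding. [cite: BasuSapozhnikov2017ECP, §2 (eq. (2.4)–(2.6))] -/
theorem image_insidePiece_iff (ζ : BondConfig W) (U R : Set W) (x : W) :
    (∃ w ∈ ι '' R, ∃ v ∈ ι '' U,
        Sym2.map ι '' ζ ∈ openConnIn (ι '' U) (ι x) v ∧ s(v, w) ∈ Sym2.map ι '' ζ) ↔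
      ∃ w ∈ R, ∃ v ∈ U, ζ ∈ openConnIn U x v ∧ s(v, w) ∈ ζ := by
  simp only [Set.exists_mem_image, map_mk_mem_image_iff, image_mem_openConnIn_iff]

/-- Reindexing a sum over the subsets of a mapped finite set. [folklore] -/
theorem sum_powerset_map {α β M : Type*} [AddCommMonoid M] (f : α ↪ β) (T : Finset α)
    (g : Finset β → M) :
    ∑ ζ ∈ (T.map f).powerset, g ζ = ∑ ζ ∈ T.powerset, g (ζ.map f) := by
  symm
  refine Finset.sum_nbij (fun ζ => ζ.map f) (fun ζ hζ => ?_)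
    (fun ζ₁ _ ζ₂ _ h => Finset.map_injective f h) (fun ζ' hζ' => ?_) (fun _ _ => rfl)
  · rw [Finset.mem_powerset] at hζ ⊢
    exact Finset.map_subset_map.2 hζ
  · rw [Finset.mem_coe, Finset.mem_powerset, Finset.subset_map_iff] at hζ'
    obtain ⟨ζ, hζ, rfl⟩ := hζ'
    exact ⟨ζ, by rw [Finset.mem_coe, Finset.mem_powerset]; exact hζ, rfl⟩

end Transport

/-! ### The edges touching the image of a deep window set -/

section Measure

variable {V W : Type*} [Fintype V] [DecidableEq V] (G : SimpleGraph V) [DecidableRel G.Adj]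
  (ι : W ↪ V)

omit [DecidableEq V] in
/-- **The `G`-edges touching `ι U` are the images of the window pairs touching `U` that are mapped
to edges**, provided no vertex of `ι U` has a neighbour off the range of `ι`. [folklore] -/
theorem mem_map_sym2Map_iff_touching {U : Set W}
    (hU : ∀ a ∈ U, ∀ v : V, G.Adj (ι a) v → ∃ b : W, v = ι b) {TW : Finset (Sym2 W)}
    (hTW : ∀ e, e ∈ TW ↔ Sym2.map ι e ∈ G.edgeSet ∧ ∃ v ∈ U, v ∈ e) (e : Sym2 V) :
    e ∈ TW.map ι.sym2Map ↔ e ∈ G.edgeFinset ∧ ∃ v ∈ ι '' U, v ∈ e := by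
  rw [Finset.mem_map]
  constructor
  · rintro ⟨e', he', rfl⟩
    obtain ⟨hE, v, hv, hve⟩ := (hTW e').1 he'
    rw [Function.Embedding.sym2Map_apply]
    exact ⟨mem_edgeFinset.2 hE, ι v, ⟨v, hv, rfl⟩, Sym2.mem_map.2 ⟨v, hve, rfl⟩⟩
  · rintro ⟨hE, v, ⟨a, ha, rfl⟩, hae⟩
    induction e using Sym2.ind with
    | h u w =>
      rw [mem_edgeFinset, mem_edgeSet] at hE
      rcases Sym2.mem_iff.1 hae with rfl | rfl
      · obtain ⟨b, rfl⟩ := hU a ha w hE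
        exact ⟨s(a, b), (hTW _).2 ⟨by rw [Sym2.map_mk]; exact hE, a, ha, Sym2.mem_mk_left a b⟩,
          rfl⟩
      · obtain ⟨b, rfl⟩ := hU a ha u hE.symm
        exact ⟨s(b, a), (hTW _).2 ⟨by rw [Sym2.map_mk]; exact hE, a, ha, Sym2.mem_mk_right b a⟩,
          rfl⟩

/-- Two configurations agreeing on the set `T` of `G`-edges touching `S` agree, once intersected
with `E(G)`, on every pair touching `S`. [folklore] -/
theorem mem_inter_edgeFinset_iff_of_inter_eq {S : Set V} {T : Finset (Sym2 V)}
    (hT : ∀ e, e ∈ T ↔ e ∈ G.edgeFinset ∧ ∃ v ∈ S, v ∈ e) {ω₁ ω₂ : BondConfig V}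
    (h : ω₁ ∩ ↑T = ω₂ ∩ ↑T) (e : Sym2 V) (he : ∃ v ∈ S, v ∈ e) :
    e ∈ ω₁ ∩ (↑G.edgeFinset : Set (Sym2 V)) ↔ e ∈ ω₂ ∩ (↑G.edgeFinset : Set (Sym2 V)) := by
  by_cases heE : e ∈ G.edgeFinset
  · have heT : e ∈ T := (hT e).2 ⟨heE, he⟩
    have h' : e ∈ ω₁ ∩ (↑T : Set (Sym2 V)) ↔ e ∈ ω₂ ∩ (↑T : Set (Sym2 V)) := by rw [h]
    simp only [Set.mem_inter_iff, Finset.mem_coe, heT, and_true] at h'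
    simp only [Set.mem_inter_iff, Finset.mem_coe, heE, and_true]
    exact h'
  · simp only [Set.mem_inter_iff, Finset.mem_coe, heE, and_false]

/-- **The inside piece is determined by the edges touching the explored set.** [folklore] -/
theorem insidePiece_iff_of_inter_eq {S Rv : Set V} {x₀ : V} {T : Finset (Sym2 V)}
    (hT : ∀ e, e ∈ T ↔ e ∈ G.edgeFinset ∧ ∃ v ∈ S, v ∈ e) (ω₁ ω₂ : BondConfig V)
    (h : ω₁ ∩ ↑T = ω₂ ∩ ↑T) :
    ω₁ ∈ {ω : BondConfig V | ∃ w ∈ Rv, ∃ v ∈ S,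
        ω ∩ (↑G.edgeFinset : Set (Sym2 V)) ∈ openConnIn S x₀ v ∧
          s(v, w) ∈ ω ∩ (↑G.edgeFinset : Set (Sym2 V))} ↔
      ω₂ ∈ {ω : BondConfig V | ∃ w ∈ Rv, ∃ v ∈ S,
        ω ∩ (↑G.edgeFinset : Set (Sym2 V)) ∈ openConnIn S x₀ v ∧
          s(v, w) ∈ ω ∩ (↑G.edgeFinset : Set (Sym2 V))} := by
  have key : ∀ {ωa ωb : BondConfig V}, ωa ∩ ↑T = ωb ∩ ↑T →
      (∃ w ∈ Rv, ∃ v ∈ S, ωa ∩ (↑G.edgeFinset : Set (Sym2 V)) ∈ openConnIn S x₀ v ∧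
          s(v, w) ∈ ωa ∩ (↑G.edgeFinset : Set (Sym2 V))) →
      ∃ w ∈ Rv, ∃ v ∈ S, ωb ∩ (↑G.edgeFinset : Set (Sym2 V)) ∈ openConnIn S x₀ v ∧
          s(v, w) ∈ ωb ∩ (↑G.edgeFinset : Set (Sym2 V)) := by
    rintro ωa ωb hab ⟨w, hw, v, hv, h1, h2⟩
    have hag := mem_inter_edgeFinset_iff_of_inter_eq G hT hab
    exact ⟨w, hw, v, hv, Percolation.BlockExploration.openConnIn_of_agree h1 fun a ha b _ h =>
      (hag _ ⟨a, ha, Sym2.mem_mk_left a b⟩).1 h, (hag _ ⟨v, hv, Sym2.mem_mk_left v w⟩).1 h2⟩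
  exact ⟨key h, key h.symm⟩

omit [DecidableEq V] in
/-- For `ζ ⊆ TW`, the pushed configuration consists of `G`-edges. [folklore] -/
theorem coe_map_inter_edgeFinset_eq {U : Set W} {TW : Finset (Sym2 W)}
    (hTW : ∀ e, e ∈ TW ↔ Sym2.map ι e ∈ G.edgeSet ∧ ∃ v ∈ U, v ∈ e) {ζ : Finset (Sym2 W)}
    (hζ : ζ ⊆ TW) :
    (↑(ζ.map ι.sym2Map) : Set (Sym2 V)) ∩ ↑G.edgeFinset = Sym2.map ι '' ↑ζ := by
  rw [coe_map_sym2Map, Set.inter_eq_left]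
  rintro _ ⟨e, he, rfl⟩
  exact Finset.mem_coe.2 (mem_edgeFinset.2 ((hTW e).1 (hζ (Finset.mem_coe.1 he))).1)

omit [DecidableEq V] in
/-- **The inside piece of a pushed window configuration** `ι ζ`, `ζ ⊆ TW`, read on `W`.
[cite: BasuSapozhnikov2017ECP, §2 (eq. (2.4)–(2.6))] -/
theorem coe_map_mem_insidePiece_iff {U R : Set W} {x : W} {TW : Finset (Sym2 W)}
    (hTW : ∀ e, e ∈ TW ↔ Sym2.map ι e ∈ G.edgeSet ∧ ∃ v ∈ U, v ∈ e) (ζ : Finset (Sym2 W))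
    (hζ : ζ ⊆ TW) :
    (↑(ζ.map ι.sym2Map) : BondConfig V) ∈ {ω : BondConfig V | ∃ w ∈ ι '' R, ∃ v ∈ ι '' U,
        ω ∩ (↑G.edgeFinset : Set (Sym2 V)) ∈ openConnIn (ι '' U) (ι x) v ∧
          s(v, w) ∈ ω ∩ (↑G.edgeFinset : Set (Sym2 V))} ↔
      (↑ζ : BondConfig W) ∈ {ζ : BondConfig W | ∃ w ∈ R, ∃ v ∈ U,
        ζ ∈ openConnIn U x v ∧ s(v, w) ∈ ζ} := by
  rw [Set.mem_setOf_eq, Set.mem_setOf_eq, coe_map_inter_edgeFinset_eq G ι hTW hζ]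
  exact image_insidePiece_iff ι (↑ζ) U R x

omit [DecidableEq V] in
/-- **The saturated wired datum event of a pushed window configuration** `ι ζ`, `ζ ⊆ TW`, read on
`W`: `ι ζ ∈ {ω | ω ∩ E(G) ∈ {𝒞 = ι U, 𝒟 = ι R} ∩ {rim wired through ι U}}` iff
`ζ ∈ {𝒞 = U, 𝒟 = R} ∩ {rim wired through U}`.
[cite: BasuSapozhnikov2017ECP, §2, definition of F_i(U,R)] -/
theorem coe_map_mem_datumEvent_iff {In Blk U R : Set W} {TW : Finset (Sym2 W)}
    (hTW : ∀ e, e ∈ TW ↔ Sym2.map ι e ∈ G.edgeSet ∧ ∃ v ∈ U, v ∈ e) (ζ : Finset (Sym2 W))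
    (hζ : ζ ⊆ TW) :
    (↑(ζ.map ι.sym2Map) : BondConfig V) ∈ {ω : BondConfig V | ω ∩ (↑G.edgeFinset : Set (Sym2 V)) ∈
        explEvent (ι '' In) (ι '' Blk) (ι '' U) (ι '' R) ∩
          {ω | ∀ r ∈ ι '' R, ∀ r₂ ∈ ι '' R, ∃ v ∈ ι '' U, ∃ v' ∈ ι '' U,
            s(v, r) ∈ ω ∧ s(v', r₂) ∈ ω ∧ ω ∈ openConnIn (ι '' U) v v'}} ↔
      (↑ζ : BondConfig W) ∈ explEvent In Blk U R ∩
        {ζ : BondConfig W | ∀ r ∈ R, ∀ r₂ ∈ R, ∃ v ∈ U, ∃ v' ∈ U,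
          s(v, r) ∈ ζ ∧ s(v', r₂) ∈ ζ ∧ ζ ∈ openConnIn U v v'} := by
  rw [Set.mem_setOf_eq, coe_map_inter_edgeFinset_eq G ι hTW hζ, Set.mem_inter_iff,
    Set.mem_inter_iff, image_mem_explEvent_iff, Set.mem_setOf_eq, Set.mem_setOf_eq,
    image_rimWired_iff]

/-! ### One graph: the inside probabilities through the window -/

variable [Fintype W] [DecidableEq W]

open Classical in
/-- **The inside probabilities of the saturated wired datum event, through the window.** Let no
vertex of `ι U` have a neighbour off the range of `ι : W ↪ V` and let `TW` be the window pairs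
touching `U` mapped to `G`-edges (`ι TW` = the `G`-edges touching `ι U`). For
`F = {ω | ω ∩ E(G) ∈ {𝒞 = ι U, 𝒟 = ι R} ∩ {rim wired through ι U}}` there are `c > 0`, `d` with
`φ^0_{G,p,q}(F ∩ A) · c = [∑_{ζ ⊆ TW, ζ ∈ F_W ∩ A_W} p^{|ζ|} (1-p)^{|TW ∖ ζ|} q^{k_W(ζ)}] · d` for
every `A` determined on `ι TW` that corresponds on the pushed configurations `ι ζ`, `ζ ⊆ TW`, to
the window event `A_W` (`F_W` = the window datum event): weight factorisation at the explored set,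
window transport of the datum event, and `k_V(ι ζ) = k_W(ζ) + #(V ∖ ι W)`.
[cite: BasuSapozhnikov2017ECP, §2 (eq. (2.4)–(2.6))] -/
theorem rcMeasure_real_explEvent_inter_mul_eq_sum_window {p q : ℝ} (hp : p ∈ Set.Icc (0 : ℝ) 1)
    (hq : 0 < q) (In Blk U R : Set W)
    (hU : ∀ a ∈ U, ∀ v : V, G.Adj (ι a) v → ∃ b : W, v = ι b)
    (TW : Finset (Sym2 W)) (hTW : ∀ e, e ∈ TW ↔ Sym2.map ι e ∈ G.edgeSet ∧ ∃ v ∈ U, v ∈ e) :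
    ∃ c d : ℝ, 0 < c ∧ ∀ (A : Set (BondConfig V)) (AW : Set (BondConfig W)),
      (∀ ω₁ ω₂ : BondConfig V, ω₁ ∩ ↑(TW.map ι.sym2Map) = ω₂ ∩ ↑(TW.map ι.sym2Map) →
        (ω₁ ∈ A ↔ ω₂ ∈ A)) →
      (∀ ζ : Finset (Sym2 W), ζ ⊆ TW →
        ((↑(ζ.map ι.sym2Map) : BondConfig V) ∈ A ↔ (↑ζ : BondConfig W) ∈ AW)) →
      (rcMeasure G p q ∅).real
          ({ω : BondConfig V | ω ∩ (↑G.edgeFinset : Set (Sym2 V)) ∈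
            explEvent (ι '' In) (ι '' Blk) (ι '' U) (ι '' R) ∩
              {ω | ∀ r ∈ ι '' R, ∀ r₂ ∈ ι '' R, ∃ v ∈ ι '' U, ∃ v' ∈ ι '' U,
                s(v, r) ∈ ω ∧ s(v', r₂) ∈ ω ∧ ω ∈ openConnIn (ι '' U) v v'}} ∩ A) * c =
        (∑ ζ ∈ TW.powerset, if (↑ζ : BondConfig W) ∈ (explEvent In Blk U R ∩
            {ζ : BondConfig W | ∀ r ∈ R, ∀ r₂ ∈ R, ∃ v ∈ U, ∃ v' ∈ U,
              s(v, r) ∈ ζ ∧ s(v', r₂) ∈ ζ ∧ ζ ∈ openConnIn U v v'}) ∩ AW then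
            p ^ #ζ * (1 - p) ^ #(TW \ ζ) * q ^ clusterCount (↑ζ : BondConfig W) ∅ else 0) * d := by
  have hT : ∀ e, e ∈ TW.map ι.sym2Map ↔ e ∈ G.edgeFinset ∧ ∃ v ∈ ι '' U, v ∈ e :=
    mem_map_sym2Map_iff_touching G ι hU hTW
  refine ⟨rcPartitionFunction G p q ∅ * q ^ clusterCount (∅ : BondConfig V) (ι '' R),
    q ^ Nat.card {u : V // u ∉ Set.range ι} *
      ∑ η ∈ (G.edgeFinset \ TW.map ι.sym2Map).powerset,
        p ^ #η * (1 - p) ^ #((G.edgeFinset \ TW.map ι.sym2Map) \ η) *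
          q ^ clusterCount ((↑η : Set (Sym2 V)) ∪ (wired (∅ : Set V)).edgeSet) (ι '' R),
    mul_pos (rcPartitionFunction_pos G hp hq ∅) (pow_pos hq _), fun A AW hA hAW => ?_⟩
  obtain ⟨hFdet, hFrim, hFwire⟩ :=
    explEvent_wired_rimHyps G (ι '' In) (ι '' Blk) (ι '' U) (ι '' R) (TW.map ι.sym2Map) hT
  have hBS : ∀ b ∈ (∅ : Set V), b ∉ ι '' U := fun b hb _ => hb
  have hC : ∀ ω₁ ω₂ : BondConfig V,
      ω₁ ∩ (↑(G.edgeFinset \ TW.map ι.sym2Map)) = ω₂ ∩ (↑(G.edgeFinset \ TW.map ι.sym2Map)) →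
      (ω₁ ∈ (Set.univ : Set (BondConfig V)) ↔ ω₂ ∈ (Set.univ : Set (BondConfig V))) :=
    fun _ _ _ => by simp only [Set.mem_univ]
  have k := rcPartitionFunction_mul_real_inter_mul_pow_eq_of_rim_wired_outside G hp hq hT hBS
    hFdet hFrim hFwire A Set.univ hA hC
  rw [Set.inter_univ, sum_powerset_map, mul_comm (rcPartitionFunction G p q ∅), mul_assoc] at k
  simp only [Set.mem_univ, if_true] at k
  refine k.trans ?_
  -- compare the window sums termwise
  rw [Finset.sum_mul, Finset.sum_mul]
  refine Finset.sum_congr rfl fun ζ hζ => ?_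
  rw [Finset.mem_powerset] at hζ
  have hiff := (Set.mem_inter_iff _ _ _).trans
    ((and_congr (coe_map_mem_datumEvent_iff G ι (In := In) (Blk := Blk) (R := R) hTW ζ hζ)
      (hAW ζ hζ)).trans
      (Set.mem_inter_iff _ _ _).symm)
  have hk : clusterCount (↑(ζ.map ι.sym2Map) : BondConfig V) ∅ =
      clusterCount (↑ζ : BondConfig W) ∅ + Nat.card {u : V // u ∉ Set.range ι} := by
    have h := clusterCount_map_image ι ζ (∅ : Set W)
    rwa [Set.image_empty] at h
  split_ifs with h₁ h₂ h₂
  · rw [Finset.card_map, ← Finset.map_sdiff, Finset.card_map, hk, pow_add]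
    ring
  · exact absurd (hiff.1 h₁) h₂
  · exact absurd (hiff.2 h₂) h₁
  · ring

end Measure

/-! ### (T) The conditional inside probabilities agree in two graphs isomorphic on the window -/

/-- **(T) Transport of the conditional inside probabilities.** Two finite graphs `G₁` on `V₁`,
`G₂` on `V₂`, a finite window `W` embedded by `ι₁, ι₂` with the same adjacency on the window and a
deep part `W₀ ⊆ W` none of whose images has a neighbour off the window (in either graph). For
exploration data `In, Blk, U ⊆ W₀`, `R ⊆ W`, `x ∈ U`, with `Fᵢ` the saturated wired datum event
`{ω | ω ∩ E(Gᵢ) ∈ {𝒞 = ιᵢ U, 𝒟 = ιᵢ R} ∩ {rim wired through ιᵢ U}}` and `Aᵢ` the inside piece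
`{ιᵢ x is joined inside ιᵢ U to a vertex carrying an open edge to ιᵢ R}`, the free random-cluster
measures satisfy `φ_{G₁}(F₁ ∩ A₁) φ_{G₂}(F₂) = φ_{G₂}(F₂ ∩ A₂) φ_{G₁}(F₁)`: the conditional inside
probabilities coincide (the inside conditional law is canonical, Basu–Sapozhnikov 2017 §2 /
Grimmett 2006 Lemma (4.13), and the window sums of the two graphs are the same).
[cite: BasuSapozhnikov2017ECP, §2] -/
theorem insideCond_eq_of_window_iso : ∀ {V₁ V₂ W : Type*} [Fintype V₁] [DecidableEq V₁] [Fintype V₂] [DecidableEq V₂] [Fintype W] [DecidableEq W] (G₁ : SimpleGraph V₁) [DecidableRel G₁.Adj] (G₂ : SimpleGraph V₂) [DecidableRel G₂.Adj] (ι₁ : W ↪ V₁) (ι₂ : W ↪ V₂) (W₀ : Set W) {p q : ℝ}, p ∈ Set.Icc (0 : ℝ) 1 → 0 < q → (∀ a b : W, G₁.Adj (ι₁ a) (ι₁ b) ↔ G₂.Adj (ι₂ a) (ι₂ b)) → (∀ a ∈ W₀, ∀ v : V₁, G₁.Adj (ι₁ a) v → ∃ b : W, v = ι₁ b) → (∀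 a ∈ W₀, ∀ v : V₂, G₂.Adj (ι₂ a) v → ∃ b : W, v = ι₂ b) → ∀ (In Blk U R : Set W) (x : W), In ⊆ W₀ → Blk ⊆ W₀ → U ⊆ W₀ → x ∈ U → let F₁ : Set (Literature.Probability.Percolation.BondConfig V₁) := {ω | ω ∩ (↑G₁.edgeFinset : Set (Sym2 V₁)) ∈ Literature.Probability.Percolation.explEvent (ι₁ '' In) (ι₁ '' Blk) (ι₁ '' U) (ι₁ '' R) ∩ {ω | ∀ r ∈ ι₁ '' R, ∀ r₂ ∈ ι₁ '' R, ∃ v ∈ ι₁ '' U, ∃ v' ∈ ι₁ '' U, s(v, r) ∈ ω ∧ s(v', r₂) ∈ ω ∧ ω ∈ Literature.Probability.Percolation.openConnIn (ι₁ '' U) v v'}}; let A₁ : Set (Literature.Probability.Percolation.BondConfig V₁) := {ω | ∃ w ∈ ι₁ '' R, ∃ v ∈ ι₁ '' U, ω ∩ (↑G₁.edgeFinset : Set (Sym2 V₁)) ∈ Literature.Probability.Percolation.openConnIn (ι₁ '' U) (ι₁ x) v ∧ s(v, w) ∈ ω ∩ (↑G₁.edgeFinset : Set (Sym2 V₁))};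 let F₂ : Set (Literature.Probability.Percolation.BondConfig V₂) := {ω | ω ∩ (↑G₂.edgeFinset : Set (Sym2 V₂)) ∈ Literature.Probability.Percolation.explEvent (ι₂ '' In) (ι₂ '' Blk) (ι₂ '' U) (ι₂ '' R) ∩ {ω | ∀ r ∈ ι₂ '' R, ∀ r₂ ∈ ι₂ '' R, ∃ v ∈ ι₂ '' U, ∃ v' ∈ ι₂ '' U, s(v, r) ∈ ω ∧ s(v', r₂) ∈ ω ∧ ω ∈ Literature.Probability.Percolation.openConnIn (ι₂ '' U) v v'}}; let A₂ : Set (Literature.Probability.Percolation.BondConfig V₂) := {ω | ∃ w ∈ ι₂ '' R, ∃ v ∈ ι₂ '' U, ω ∩ (↑G₂.edgeFinset : Set (Sym2 V₂)) ∈ Literature.Probability.Percolation.openConnIn (ι₂ '' U) (ι₂ x) v ∧ s(v, w) ∈ ω ∩ (↑G₂.edgeFinset : Set (Sym2 V₂))}; (Literature.Probability.LatticeModels.rcMeasure G₁ p q ∅).real (F₁ ∩ A₁) * (Literature.Probability.LatticeModels.rcMeasure G₂ p q ∅).real F₂ = (Literature.Probability.LatticeModels.rcMeasure G₂ p q ∅).real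 (F₂ ∩ A₂) * (Literature.Probability.LatticeModels.rcMeasure G₁ p q ∅).real F₁ := by
  intro V₁ V₂ W _ _ _ _ _ _ G₁ _ G₂ _ ι₁ ι₂ W₀ p q hp hq hadj hnb₁ hnb₂ In Blk U R x _hIn _hBlk hUW₀
    _hx F₁ A₁ F₂ A₂
  classical
  -- the window pairs touching `U` that are edges (the same for the two graphs)
  set TW : Finset (Sym2 W) :=
    Finset.univ.filter (fun e => Sym2.map ι₁ e ∈ G₁.edgeSet ∧ ∃ v ∈ U, v ∈ e) with hTWdef
  have hTW₁ : ∀ e, e ∈ TW ↔ Sym2.map ι₁ e ∈ G₁.edgeSet ∧ ∃ v ∈ U, v ∈ e := fun e => by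
    rw [hTWdef, Finset.mem_filter, and_iff_right (Finset.mem_univ e)]
  have hTW₂ : ∀ e, e ∈ TW ↔ Sym2.map ι₂ e ∈ G₂.edgeSet ∧ ∃ v ∈ U, v ∈ e := fun e => by
    rw [hTW₁]
    induction e using Sym2.ind with
    | h a b => rw [Sym2.map_mk, Sym2.map_mk, mem_edgeSet, mem_edgeSet, hadj a b]
  have hU₁ : ∀ a ∈ U, ∀ v : V₁, G₁.Adj (ι₁ a) v → ∃ b : W, v = ι₁ b := fun a ha => hnb₁ a (hUW₀ ha)
  have hU₂ : ∀ a ∈ U, ∀ v : V₂, G₂.Adj (ι₂ a) v → ∃ b : W, v = ι₂ b := fun a ha => hnb₂ a (hUW₀ ha)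
  obtain ⟨c₁, d₁, hc₁, h₁⟩ :=
    rcMeasure_real_explEvent_inter_mul_eq_sum_window G₁ ι₁ hp hq In Blk U R hU₁ TW hTW₁
  obtain ⟨c₂, d₂, hc₂, h₂⟩ :=
    rcMeasure_real_explEvent_inter_mul_eq_sum_window G₂ ι₂ hp hq In Blk U R hU₂ TW hTW₂
  -- the four factorised probabilities (inside piece / whole datum event, in either graph)
  set AW : Set (BondConfig W) := {ζ | ∃ w ∈ R, ∃ v ∈ U, ζ ∈ openConnIn U x v ∧ s(v, w) ∈ ζ}
  have h1A := h₁ A₁ AW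
    (insidePiece_iff_of_inter_eq G₁ (mem_map_sym2Map_iff_touching G₁ ι₁ hU₁ hTW₁))
    (fun ζ hζ => coe_map_mem_insidePiece_iff G₁ ι₁ hTW₁ ζ hζ)
  have h2A := h₂ A₂ AW
    (insidePiece_iff_of_inter_eq G₂ (mem_map_sym2Map_iff_touching G₂ ι₂ hU₂ hTW₂))
    (fun ζ hζ => coe_map_mem_insidePiece_iff G₂ ι₂ hTW₂ ζ hζ)
  have h1u := h₁ Set.univ Set.univ (fun _ _ _ => Iff.rfl) fun _ _ => Iff.rfl
  have h2u := h₂ Set.univ Set.univ (fun _ _ _ => Iff.rfl) fun _ _ => Iff.rfl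
  rw [Set.inter_univ F₁] at h1u
  rw [Set.inter_univ F₂] at h2u
  have key : ((rcMeasure G₁ p q ∅).real (F₁ ∩ A₁) * c₁) * ((rcMeasure G₂ p q ∅).real F₂ * c₂) =
      ((rcMeasure G₂ p q ∅).real (F₂ ∩ A₂) * c₂) * ((rcMeasure G₁ p q ∅).real F₁ * c₁) := by
    rw [h1A, h1u, h2A, h2u]; ring
  apply mul_left_cancel₀ (mul_ne_zero hc₁.ne' hc₂.ne')
  linear_combination key

end Literature.Probability.LatticeModels
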